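import Summits.Ventures.PercRepro2.CaseOneStarCfQtI22
import Summits.Ventures.PercRepro2.CaseOneStarCfQtI22SplitA
import Summits.Ventures.PercRepro2.CaseOneStarCfQtI22SplitB

/-!
# The marked star: `cfQtI22_bern` re-proved in small kernel steps
(blind cell PercRepro2, p1 g18; S5 §2.1 (K9) (q); OPS l.38 (i) — RULING (F) 2026-08-25T23:42:22Z)

The `(r, s)`-Bernstein coefficients `cBQtI22kl` of CaseOneStarCfQtI22.lean are integer combinations of the monomial
coefficients `aQtI22ij` (CaseOneStarCfQtI22Mono.lean): `cBQtI22kl = Σ_{i ≤ k, j ≤ l} c(k,i) c(l,j) aQtI22ij` with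
`c(k,i) = 3 · C(k,i) / C(3,i)` (`cBQtI22kl_eq`); for the index pairs without a Bernstein coefficient the combination
vanishes (`aQtI22vkl`). With the monomial expansion `cfQtI22_mono` the Bernstein identity `cfQtI22_bern'` — the SAME
statement as `cfQtI22_bern` — is a linear identity in `r`, `s` and the atoms `aQtI22ij m`; every step elaborates
on a referee node (the cell identities are spread over modules so that each file stays small in kernel memory). -/

namespace Summit.Ventures.PercRepro2

namespace CaseOne

section CfQtI22Split
variable {R : Type*} [CommRing R]

set_option maxHeartbeats 0 in
/-- **The `(r, s)`-Bernstein form of `cfQtI22`** (the statement of `cfQtI22_bern`, verbatim), proved in small kernel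
steps: the monomial expansion, the coefficient identities, then one linear step. -/
theorem cfQtI22_bern' (r s : R) (m : SCells R) :
    9 * cfQtI22 r s m = (3 : R) * r ^ 0 * (1 - r) ^ 3 * s ^ 1 * (1 - s) ^ 2 * cBQtI2201 m + (3 : R) * r ^ 0 * (1 - r) ^ 3 * s ^ 2 * (1 - s) ^ 1 * cBQtI2202 m + (3 : R) * r ^ 1 * (1 - r) ^ 2 * s ^ 0 * (1 - s) ^ 3 * cBQtI2210 m + (9 : R) * r ^ 1 * (1 - r) ^ 2 * s ^ 1 * (1 - s) ^ 2 * cBQtI2211 m + (9 : R) * r ^ 1 * (1 - r) ^ 2 * s ^ 2 * (1 - s) ^ 1 * cBQtI2212 m + (3 : R) * r ^ 2 * (1 - r) ^ 1 * s ^ 0 * (1 - s) ^ 3 * cBQtI2220 m + (9 : R) * r ^ 2 * (1 - r) ^ 1 * s ^ 1 * (1 - s) ^ 2 * cBQtI2221 m + (9 : R) * r ^ 2 * (1 - r) ^ 1 * s ^ 2 * (1 - s) ^ 1 * cBQtI2222 m := by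
  rw [cfQtI22_mono, cBQtI2201_eq, cBQtI2202_eq, cBQtI2210_eq, cBQtI2211_eq, cBQtI2212_eq, cBQtI2220_eq, cBQtI2221_eq, cBQtI2222_eq]
  linear_combination (1 : R) * r ^ 0 * (1 - r) ^ 3 * s ^ 3 * (1 - s) ^ 0 * aQtI22v03 m + (3 : R) * r ^ 1 * (1 - r) ^ 2 * s ^ 3 * (1 - s) ^ 0 * aQtI22v13 m + (3 : R) * r ^ 2 * (1 - r) ^ 1 * s ^ 3 * (1 - s) ^ 0 * aQtI22v23 m + (1 : R) * r ^ 3 * (1 - r) ^ 0 * s ^ 0 * (1 - s) ^ 3 * aQtI22v30 m + (3 : R) * r ^ 3 * (1 - r) ^ 0 * s ^ 1 * (1 - s) ^ 2 * aQtI22v31 m + (3 : R) * r ^ 3 * (1 - r) ^ 0 * s ^ 2 * (1 - s) ^ 1 * aQtI22v32 m + (1 : R) * r ^ 3 * (1 - r) ^ 0 * s ^ 3 * (1 - s) ^ 0 * aQtI22v33 m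

end CfQtI22Split

end CaseOne

end Summit.Ventures.PercRepro2
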